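import Literature.NumberTheory.NumberFields.EquivariantIwasawaLemmaTotallyRamified
import Literature.NumberTheory.EllipticCurves.DivisionField
import Literature.NumberTheory.EllipticCurves.FineSelmerClassGroupCriterionTorsionPointFieldEigen
import HarnessLib

/-!
# The `E[p]`-part of the class group along the cyclotomic tower `ℚ_n(E[p])` (door L6 for elliptic curves)

Topic `NumberTheory/EllipticCurves` (grouping namespace `DeoRaySujatha2023`, next to
`FineSelmerClassGroupCriterion*.lean`).  THEOREM-ONLY file (no definition, no named fact, no `sorry`),
written by the literature seat `bsd-potss-conjA-anchor` g16 (cell `bsd-potss`; serves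
stmt-BirchSwinnertonDyer-19386 / 19413; closes nothing; neither Conjecture A nor BSD is proved for any
curve here).  The elliptic-curve instance of the equivariant Iwasawa lemma
(`Literature/NumberTheory/NumberFields/EquivariantIwasawaLemma*.lean`, files I–VII): for `E/ℚ`, an odd
prime `p` with (c1) `p ∤ #Gal(ℚ(E[p])/ℚ)`, the cyclotomic `ℤ_p`-extension `ℚ_∞ = ⋃ ℚ_n`, and `V = E[p]`:

> (c2*)₀ every `Γ_ℚ`-equivariant additive map `Cl(𝓞_{ℚ(E[p])}) → E[p]` is zero, and
> (c3*) `E[p]^{D_p} = 0` (no non-zero `p`-torsion point fixed by the decomposition group at `p`, i.e.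
> `E(ℚ_p)[p] = 0`)
> ⟹ for every `n`, every `Γ_ℚ`-equivariant additive map `Cl(𝓞_{ℚ_n(E[p])}) → E[p]` is zero

(«the `E[p]`-isotypic part of `Cl(ℚ_n(E[p])) ⊗ 𝔽_p` never appears up the cyclotomic tower»).  Hypothesis
(c2*)₀ is the conclusion shape of `equivariantHom_classGroup_eq_zero_of_eigenHom_subfield` (file
`FineSelmerClassGroupCriterionTorsionPointFieldEigen.lean`, with `S := ∅`) up to the bridge
`EquivariantIwasawaLemma.equivariant_iff_forall_mk0`; (c3*) is the `v = p` part of hypothesis (c3) of the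
Deo–Ray–Sujatha facts (`GreenbergSelmer.decomp`).  The conclusion at layer `n` contains hypothesis (c2) of
Deo–Ray–Sujatha Thm. 3.8 for the base field `ℚ_n` (maps killing the `S`-classes are in particular
arbitrary maps); the passage from there to Conjecture A over `ℚ_n` (their Thm. 3.8/3.9 over a general base)
is not in the tree.  `homTrivial_divisionField_cyclotomicTower_of_eigenHom_subfield` feeds (c2*)₀ from the
tautological-eigenspace test on `Cl(ℚ(P))` (the eigen file, `S = ∅`), so that the per-curve inputs are:
(c1), `E[p]` irreducible, the eigen-test datum at layer `0`, `E(ℚ_p)[p] = 0`;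
`homTrivial_divisionField_cyclotomicTower_of_not_dvd_classNumber` is the class-number entry point
((c2*)₀ ⟸ `p ∤ h(ℚ(E[p]))`), with (c3) in the Deo–Ray–Sujatha `E[p^∞]`-currency.

## References

* L. C. Washington, *Introduction to Cyclotomic Fields*, 2nd ed., GTM 83 (1997), §13.1, Prop. 13.2,
  §13.3 Lemmas 13.14–13.15, Thm. 10.4. [Washington1997]
* S. V. Deo, A. Ray, R. Sujatha, *On the μ equals zero conjecture for fine Selmer groups in Iwasawa
  theory*, Pure Appl. Math. Q. 19 (2023), §3 Thm. 3.8 (c2), (c3) (arXiv:2202.09937 p. 9). [DeoRaySujatha2023]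
-/

noncomputable section

open scoped Pointwise nonZeroDivisors
open NumberField Field IntermediateField IsDedekindDomain WeierstrassCurve
open Literature.NumberTheory.GaloisRepresentations Literature.NumberTheory.NumberFields

namespace Literature.NumberTheory.EllipticCurves.DeoRaySujatha2023

/-- `p ∤ #Gal(L/k) ⟹ p ∤ [L : k]` (stated for a general base field `k`, so that at `k = ℚ` no
`Algebra ℚ _` instance is synthesized afresh). [folklore] -/
private theorem not_dvd_finrank_of_not_dvd_card {k : Type} [Field k]
    (L : IntermediateField k (AlgebraicClosure k)) [FiniteDimensional k L] [IsGalois k L] {p : ℕ}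
    (h : ¬ p ∣ Nat.card (L ≃ₐ[k] L)) : ¬ p ∣ Module.finrank k L := by
  rwa [← IsGalois.card_aut_eq_finrank k L]

/-- A finite subextension of `k̄/k`, `k` a number field, is a number field (general `k`, same reason).
[folklore] -/
private theorem numberField_of_finiteDimensional {k : Type} [Field k] [NumberField k]
    (E : IntermediateField k (AlgebraicClosure k)) [FiniteDimensional k E] : NumberField E :=
  NumberField.of_module_finite k E

/-- **Door L6 for an elliptic curve: the `E[p]`-part of the class group is absent along the cyclotomic
tower.**  `E/ℚ` elliptic (`W`), `p` an odd prime, `κ` the cyclotomic `ℤ_p`-extension of `ℚ` with layers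
`ℚ_n = κ.layer n`, `L_n = ℚ(E[p])ℚ_n = W.divisionField p ⊔ κ.layer n`.  Assume (c1)
`p ∤ #Gal(ℚ(E[p])/ℚ)`; (c2*)₀ every additive `Γ_ℚ`-equivariant `Cl(𝓞_{ℚ(E[p])}) → E[p]` is zero
(equivariance through `τ ↦ ClassGroup.mulEquiv (intAut τ|_{ℚ(E[p])})`); (c3*) for the place `v ∋ p` of
`ℚ`, no non-zero `x ∈ E[p]` is fixed by the decomposition group `GreenbergSelmer.decomp v` (⟸
`E(ℚ_p)[p] = 0`).  Then for every `n` every additive `Γ_ℚ`-equivariant `Cl(𝓞_{L_n}) → E[p]` is zero.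
Proof: `EquivariantIwasawaLemma.equivariantHom_classGroup_eq_zero_layer_compositum_tower_of_totallyRamified`
(`k = ℚ`, `L₀ = ℚ(E[p])`, `V = E[p]`, `p` totally ramified in `ℚ_∞`), with `E[p]` `p`-torsion and fixed by
`Γ_{ℚ(E[p])}` (`absRestrictNormalHom_divisionField_eq_one_iff`).
[cite: Washington1997, §13.1 Prop. 13.2, §13.3 Lemmas 13.14–13.15 and Thm. 10.4 (proof)]
[cite: DeoRaySujatha2023, §3 Thm. 3.8 hypotheses (c1)–(c3) (arXiv:2202.09937 p. 9)] -/
theorem homTrivial_divisionField_cyclotomicTower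
    (W : WeierstrassCurve ℚ) [W.IsElliptic] (p : ℕ) [Fact p.Prime] [NeZero p] (hp2 : p ≠ 2)
    [NumberField (W.divisionField p)]
    (hG : ¬ p ∣ Nat.card ((W.divisionField p) ≃ₐ[ℚ] (W.divisionField p)))
    {κ : ZpExtension ℚ p} (hκ : κ.IsCyclotomic)
    (h0 : ∀ μ : Additive (ClassGroup (𝓞 (W.divisionField p))) →+ geomTorsion W (p : ℤ),
      (∀ (τ : absoluteGaloisGroup ℚ) (c : ClassGroup (𝓞 (W.divisionField p))),
        μ (Additive.ofMul (ClassGroup.mulEquiv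
          (AmbiguousClass.intAut (absRestrictNormalHom (W.divisionField p) τ)) c)) =
          τ • μ (Additive.ofMul c)) → μ = 0)
    (hD : ∀ v : HeightOneSpectrum (𝓞 ℚ), ((p : ℕ) : 𝓞 ℚ) ∈ v.asIdeal →
      ∀ x : geomTorsion W (p : ℤ), (∀ d ∈ GreenbergSelmer.decomp v, d • x = x) → x = 0)
    (n : ℕ) :
    haveI := κ.isGalois_layer_holds n
    ∀ (f : Additive (ClassGroup (𝓞 ↥(W.divisionField p ⊔ κ.layer n))) →+ geomTorsion W (p : ℤ)),
      (∀ (τ : absoluteGaloisGroup ℚ) (c : ClassGroup (𝓞 ↥(W.divisionField p ⊔ κ.layer n))),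
        f (Additive.ofMul (ClassGroup.mulEquiv (AmbiguousClass.intAut
          (absRestrictNormalHom (W.divisionField p ⊔ κ.layer n) τ)) c)) = τ • f (Additive.ofMul c)) →
      f = 0 := by
  haveI hgal := fun m => κ.isGalois_layer_holds m
  haveI hfd := fun m => κ.finiteDimensional_layer_holds m
  haveI hNF : ∀ m, NumberField ↥(W.divisionField p ⊔ κ.layer m) :=
    fun m => numberField_of_finiteDimensional (W.divisionField p ⊔ κ.layer m)
  intro f hf
  have hL₀ := not_dvd_finrank_of_not_dvd_card (W.divisionField p) hG
  -- `E[p]` is `p`-torsion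
  have hpV : ∀ v : geomTorsion W (p : ℤ), p • v = 0 := by
    intro v
    apply Subtype.ext
    have hv : ((v : geomTorsion W (p : ℤ)) : geomPoints W) ∈
        AddSubgroup.torsionBy (geomPoints W) (p : ℤ) := v.2
    rw [AddSubgroup.torsionBy, Submodule.mem_toAddSubgroup, Submodule.mem_torsionBy_iff] at hv
    rw [AddSubgroupClass.coe_nsmul, ZeroMemClass.coe_zero, ← natCast_zsmul]
    exact hv
  exact EquivariantIwasawaLemma.equivariantHom_classGroup_eq_zero_layer_compositum_tower_of_totallyRamified
    hp2 κ (W.divisionField p) hL₀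
    (EquivariantIwasawaLemma.exists_isMaximal_inertia_sup_kerSubgroup_eq_top_of_isCyclotomic hκ)
    hpV (fun τ hτ v => (W.absRestrictNormalHom_divisionField_eq_one_iff p τ).mp hτ v) h0 hD n f hf

/-- **Door L6 for an elliptic curve, with (c2*)₀ from the tautological eigenspace of `Cl(ℚ(P))`.**  As
`homTrivial_divisionField_cyclotomicTower`, with hypothesis (c2*)₀ replaced by the data of
`equivariantHom_classGroup_eq_zero_of_eigenHom_subfield` with `S = ∅`: `E[p]` irreducible, a subfield
`K ⊆ ℚ(E[p])` whose absolute Galois group fixes a non-zero `P ∈ E[p]` (`K = ℚ(P)`), and the eigen-test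
«every additive `μ : Cl(𝓞_K) → ZMod p` with `μ([σ̄ I]) = a • μ([I])` whenever `τ|_K = σ̄`, `τ • P = a • P`,
is zero» (NO `S`-classes quotiented out; numerically: no tautological line in `Cl(ℚ(P)) ⊗ 𝔽_p`, a fortiori
`p ∤ h(ℚ(P))`).  Conclusion: for every `n`, every additive `Γ_ℚ`-equivariant `Cl(𝓞_{ℚ(E[p])ℚ_n}) → E[p]` is
zero. [cite: Washington1997, §13.3 Lemmas 13.14–13.15 and Thm. 10.4 (proof)]
[cite: DeoRaySujatha2023, §3 Thm. 3.8 (c2) and the definition of H′_L (arXiv:2202.09937 p. 9)] -/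
theorem homTrivial_divisionField_cyclotomicTower_of_eigenHom_subfield
    (W : WeierstrassCurve ℚ) [W.IsElliptic] (p : ℕ) [Fact p.Prime] [NeZero p] (hp2 : p ≠ 2)
    [NumberField (W.divisionField p)]
    (hirr : W.HasIrreducibleModPGaloisRep p)
    (hG : ¬ p ∣ Nat.card ((W.divisionField p) ≃ₐ[ℚ] (W.divisionField p)))
    (K : IntermediateField ℚ (W.divisionField p)) [NumberField K]
    (P : geomTorsion W (p : ℤ)) (hP0 : P ≠ 0)
    (hPK : ∀ τ : absoluteGaloisGroup ℚ,
      (∀ x : K, absRestrictNormalHom (W.divisionField p) τ (x : W.divisionField p) = x) → τ • P = P)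
    (hEig : ∀ μ : Additive (ClassGroup (𝓞 K)) →+ ZMod p,
      (∀ (τ : absoluteGaloisGroup ℚ) (σ : K ≃ₐ[ℚ] K) (a : ℕ),
          (∀ x : K, absRestrictNormalHom (W.divisionField p) τ (x : W.divisionField p) =
            ((σ x : K) : W.divisionField p)) → τ • P = a • P →
          ∀ (I J : (Ideal (𝓞 K))⁰),
            (J : Ideal (𝓞 K)) = (I : Ideal (𝓞 K)).map (AmbiguousClass.intAut σ : 𝓞 K →+* 𝓞 K) →
            μ (Additive.ofMul (ClassGroup.mk0 J)) = a • μ (Additive.ofMul (ClassGroup.mk0 I))) →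
      μ = 0)
    {κ : ZpExtension ℚ p} (hκ : κ.IsCyclotomic)
    (hD : ∀ v : HeightOneSpectrum (𝓞 ℚ), ((p : ℕ) : 𝓞 ℚ) ∈ v.asIdeal →
      ∀ x : geomTorsion W (p : ℤ), (∀ d ∈ GreenbergSelmer.decomp v, d • x = x) → x = 0)
    (n : ℕ) :
    haveI := κ.isGalois_layer_holds n
    ∀ (f : Additive (ClassGroup (𝓞 ↥(W.divisionField p ⊔ κ.layer n))) →+ geomTorsion W (p : ℤ)),
      (∀ (τ : absoluteGaloisGroup ℚ) (c : ClassGroup (𝓞 ↥(W.divisionField p ⊔ κ.layer n))),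
        f (Additive.ofMul (ClassGroup.mulEquiv (AmbiguousClass.intAut
          (absRestrictNormalHom (W.divisionField p ⊔ κ.layer n) τ)) c)) = τ • f (Additive.ofMul c)) →
      f = 0 := by
  -- `E[p]` is `p`-torsion and fixed by `Γ_{ℚ(E[p])}`
  have hpV : ∀ v : geomTorsion W (p : ℤ), p • v = 0 := by
    intro v
    apply Subtype.ext
    have hv : ((v : geomTorsion W (p : ℤ)) : geomPoints W) ∈
        AddSubgroup.torsionBy (geomPoints W) (p : ℤ) := v.2
    rw [AddSubgroup.torsionBy, Submodule.mem_toAddSubgroup, Submodule.mem_torsionBy_iff] at hv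
    rw [AddSubgroupClass.coe_nsmul, ZeroMemClass.coe_zero, ← natCast_zsmul]
    exact hv
  have hV : ∀ τ : absoluteGaloisGroup ℚ, absRestrictNormalHom (W.divisionField p) τ = 1 →
      ∀ v : geomTorsion W (p : ℤ), τ • v = v :=
    fun τ hτ v => (W.absRestrictNormalHom_divisionField_eq_one_iff p τ).mp hτ v
  -- (c2*)₀ from the eigen hypothesis with `S = ∅`
  have h0 : ∀ μ : Additive (ClassGroup (𝓞 (W.divisionField p))) →+ geomTorsion W (p : ℤ),
      (∀ (τ : absoluteGaloisGroup ℚ) (c : ClassGroup (𝓞 (W.divisionField p))),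
        μ (Additive.ofMul (ClassGroup.mulEquiv
          (AmbiguousClass.intAut (absRestrictNormalHom (W.divisionField p) τ)) c)) =
          τ • μ (Additive.ofMul c)) → μ = 0 := by
    intro μ hμ
    refine equivariantHom_classGroup_eq_zero_of_eigenHom_subfield (W.divisionField p) p hG hV hpV hirr
      K P hP0 hPK (∅ : Set ℕ) (fun ν h1 _ => hEig ν h1) μ
      ((EquivariantIwasawaLemma.equivariant_iff_forall_mk0
        (absRestrictNormalHom (W.divisionField p)) μ).mp hμ) ?_
    intro 𝔓 q hq _
    exact absurd hq (Set.notMem_empty q)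
  exact homTrivial_divisionField_cyclotomicTower W p hp2 hG hκ h0 hD n

/-- **(c3*) in the `E[p^∞]`-form of the Deo–Ray–Sujatha facts implies the `E[p]`-form used here**: if at
the place `v` no non-zero `p`-torsion element of `E[p^∞]` is fixed by `D_v` (hypothesis (c3) of
`thm39_fineSelmerDual_moduleFinite_of_homTrivial_divisionField` at `v`), then no non-zero element of
`E[p]` is fixed by `D_v` (`E[p] ⊆ E[p^∞]` with the same Galois action).
[cite: DeoRaySujatha2023, §3 Thm. 3.8 hypothesis (c3) (arXiv:2202.09937 p. 9)] -/
theorem geomTorsion_fixed_eq_zero_of_geomPrimaryTorsion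
    (W : WeierstrassCurve ℚ) [W.IsElliptic] (p : ℕ) [Fact p.Prime] (v : HeightOneSpectrum (𝓞 ℚ))
    (h : ∀ x : W.geomPrimaryTorsion p, p • x = 0 →
      (∀ d ∈ GreenbergSelmer.decomp v, d • x = x) → x = 0)
    (x : geomTorsion W (p : ℤ)) (hx : ∀ d ∈ GreenbergSelmer.decomp v, d • x = x) : x = 0 := by
  have hxP : (x : geomPoints W) ∈ geomPrimaryTorsion W p := W.geomTorsion_le_geomPrimaryTorsion p x.2
  set y : W.geomPrimaryTorsion p := ⟨x, hxP⟩ with hydef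
  have hpx : (p : ℤ) • (x : geomPoints W) = 0 := by
    have hv : ((x : geomTorsion W (p : ℤ)) : geomPoints W) ∈
        AddSubgroup.torsionBy (geomPoints W) (p : ℤ) := x.2
    rwa [AddSubgroup.torsionBy, Submodule.mem_toAddSubgroup, Submodule.mem_torsionBy_iff] at hv
  have hy0 : y = 0 := by
    refine h y ?_ ?_
    · apply Subtype.ext
      rw [AddSubgroupClass.coe_nsmul, ZeroMemClass.coe_zero, ← natCast_zsmul]
      exact hpx
    · intro d hd
      apply Subtype.ext
      exact congrArg (fun z : geomTorsion W (p : ℤ) => (z : geomPoints W)) (hx d hd)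
  apply Subtype.ext
  exact congrArg (fun z : W.geomPrimaryTorsion p => (z : geomPoints W)) hy0

/-- **Door L6 for an elliptic curve, all inputs in the currency of the Deo–Ray–Sujatha facts**:
`homTrivial_divisionField_cyclotomicTower_of_eigenHom_subfield` with (c3*) stated as hypothesis (c3) of
`thm39_fineSelmerDual_moduleFinite_of_homTrivial_divisionField` AT THE PLACE `p` ONLY («no non-zero
`p`-torsion element of `E[p^∞]` fixed by `D_p`», i.e. `E(ℚ_p)[p] = 0`).
[cite: Washington1997, §13.3 Lemmas 13.14–13.15 and Thm. 10.4 (proof)]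
[cite: DeoRaySujatha2023, §3 Thm. 3.8 (c1)–(c3) (arXiv:2202.09937 p. 9)] -/
theorem homTrivial_divisionField_cyclotomicTower_of_eigenHom_subfield'
    (W : WeierstrassCurve ℚ) [W.IsElliptic] (p : ℕ) [Fact p.Prime] [NeZero p] (hp2 : p ≠ 2)
    [NumberField (W.divisionField p)]
    (hirr : W.HasIrreducibleModPGaloisRep p)
    (hG : ¬ p ∣ Nat.card ((W.divisionField p) ≃ₐ[ℚ] (W.divisionField p)))
    (K : IntermediateField ℚ (W.divisionField p)) [NumberField K]
    (P : geomTorsion W (p : ℤ)) (hP0 : P ≠ 0)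
    (hPK : ∀ τ : absoluteGaloisGroup ℚ,
      (∀ x : K, absRestrictNormalHom (W.divisionField p) τ (x : W.divisionField p) = x) → τ • P = P)
    (hEig : ∀ μ : Additive (ClassGroup (𝓞 K)) →+ ZMod p,
      (∀ (τ : absoluteGaloisGroup ℚ) (σ : K ≃ₐ[ℚ] K) (a : ℕ),
          (∀ x : K, absRestrictNormalHom (W.divisionField p) τ (x : W.divisionField p) =
            ((σ x : K) : W.divisionField p)) → τ • P = a • P →
          ∀ (I J : (Ideal (𝓞 K))⁰),
            (J : Ideal (𝓞 K)) = (I : Ideal (𝓞 K)).map (AmbiguousClass.intAut σ : 𝓞 K →+* 𝓞 K) →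
            μ (Additive.ofMul (ClassGroup.mk0 J)) = a • μ (Additive.ofMul (ClassGroup.mk0 I))) →
      μ = 0)
    {κ : ZpExtension ℚ p} (hκ : κ.IsCyclotomic)
    (hc3 : ∀ v : HeightOneSpectrum (𝓞 ℚ), ((p : ℕ) : 𝓞 ℚ) ∈ v.asIdeal →
      ∀ x : W.geomPrimaryTorsion p, p • x = 0 →
        (∀ d ∈ GreenbergSelmer.decomp v, d • x = x) → x = 0)
    (n : ℕ) :
    haveI := κ.isGalois_layer_holds n
    ∀ (f : Additive (ClassGroup (𝓞 ↥(W.divisionField p ⊔ κ.layer n))) →+ geomTorsion W (p : ℤ)),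
      (∀ (τ : absoluteGaloisGroup ℚ) (c : ClassGroup (𝓞 ↥(W.divisionField p ⊔ κ.layer n))),
        f (Additive.ofMul (ClassGroup.mulEquiv (AmbiguousClass.intAut
          (absRestrictNormalHom (W.divisionField p ⊔ κ.layer n) τ)) c)) = τ • f (Additive.ofMul c)) →
      f = 0 :=
  homTrivial_divisionField_cyclotomicTower_of_eigenHom_subfield W p hp2 hirr hG K P hP0 hPK hEig hκ
    (fun v hv x hx => geomTorsion_fixed_eq_zero_of_geomPrimaryTorsion W p v (hc3 v hv) x hx) n

/-- A homomorphism from a finite abelian group of order prime to `p` to a `p`-torsion group is zero.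
[folklore] -/
private theorem addMonoidHom_eq_zero_of_not_dvd_card' {G : Type*} [CommGroup G] [Finite G] {p : ℕ}
    (hp : p.Prime) (hG : ¬ p ∣ Nat.card G) {V : Type*} [AddCommGroup V] (hpV : ∀ v : V, p • v = 0)
    (μ : Additive G →+ V) : μ = 0 := by
  refine AddMonoidHom.ext fun a => ?_
  have ha : Nat.card G • a = 0 := by
    rw [← ofMul_toMul a, ← ofMul_pow, pow_card_eq_one', ofMul_one]
  have h1 : ((Nat.card G : ℕ) : ℤ) • μ a = 0 := by
    rw [natCast_zsmul, ← map_nsmul, ha, map_zero]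
  have h2 : ((p : ℕ) : ℤ) • μ a = 0 := by rw [natCast_zsmul, hpV]
  have hcop : IsCoprime (Nat.card G : ℤ) (p : ℤ) :=
    Nat.isCoprime_iff_coprime.mpr (Nat.coprime_comm.mp ((Nat.Prime.coprime_iff_not_dvd hp).mpr hG))
  obtain ⟨u, v, huv⟩ := hcop
  have h : (u * (Nat.card G : ℤ) + v * (p : ℤ)) • μ a = 0 := by
    rw [add_smul, mul_smul, mul_smul, h1, h2, smul_zero, smul_zero, add_zero]
  rwa [huv, one_smul] at h

/-- **Door L6 for an elliptic curve from `p ∤ h(ℚ(E[p]))`** (the commonest certificate of the cell's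
census: `3 ∤ h(ℚ(E[3]))`): `E/ℚ`, `p` odd, (c1) `p ∤ #Gal(ℚ(E[p])/ℚ)`, `p ∤ #Cl(𝓞_{ℚ(E[p])})`, `κ`
cyclotomic, (c3) at `p` in the Deo–Ray–Sujatha currency (`E(ℚ_p)[p] = 0`) ⟹ for every `n`, every additive
`Γ_ℚ`-equivariant `Cl(𝓞_{ℚ(E[p])ℚ_n}) → E[p]` is zero.  ((c2*)₀ is automatic: `E[p]` is `p`-torsion and
`#Cl` is prime to `p`.) [cite: Washington1997, §13.3 Lemmas 13.14–13.15 and Thm. 10.4 (proof)]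
[cite: DeoRaySujatha2023, §3 Thm. 3.9 (b) (the class-number form) (arXiv:2202.09937 p. 10)] -/
theorem homTrivial_divisionField_cyclotomicTower_of_not_dvd_classNumber
    (W : WeierstrassCurve ℚ) [W.IsElliptic] (p : ℕ) [Fact p.Prime] [NeZero p] (hp2 : p ≠ 2)
    [NumberField (W.divisionField p)]
    (hG : ¬ p ∣ Nat.card ((W.divisionField p) ≃ₐ[ℚ] (W.divisionField p)))
    (hh : ¬ p ∣ Nat.card (ClassGroup (𝓞 (W.divisionField p))))
    {κ : ZpExtension ℚ p} (hκ : κ.IsCyclotomic)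
    (hc3 : ∀ v : HeightOneSpectrum (𝓞 ℚ), ((p : ℕ) : 𝓞 ℚ) ∈ v.asIdeal →
      ∀ x : W.geomPrimaryTorsion p, p • x = 0 →
        (∀ d ∈ GreenbergSelmer.decomp v, d • x = x) → x = 0)
    (n : ℕ) :
    haveI := κ.isGalois_layer_holds n
    ∀ (f : Additive (ClassGroup (𝓞 ↥(W.divisionField p ⊔ κ.layer n))) →+ geomTorsion W (p : ℤ)),
      (∀ (τ : absoluteGaloisGroup ℚ) (c : ClassGroup (𝓞 ↥(W.divisionField p ⊔ κ.layer n))),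
        f (Additive.ofMul (ClassGroup.mulEquiv (AmbiguousClass.intAut
          (absRestrictNormalHom (W.divisionField p ⊔ κ.layer n) τ)) c)) = τ • f (Additive.ofMul c)) →
      f = 0 := by
  have hp : p.Prime := Fact.out
  -- `E[p]` is `p`-torsion
  have hpV : ∀ v : geomTorsion W (p : ℤ), p • v = 0 := by
    intro v
    apply Subtype.ext
    have hv : ((v : geomTorsion W (p : ℤ)) : geomPoints W) ∈
        AddSubgroup.torsionBy (geomPoints W) (p : ℤ) := v.2
    rw [AddSubgroup.torsionBy, Submodule.mem_toAddSubgroup, Submodule.mem_torsionBy_iff] at hv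
    rw [AddSubgroupClass.coe_nsmul, ZeroMemClass.coe_zero, ← natCast_zsmul]
    exact hv
  exact homTrivial_divisionField_cyclotomicTower W p hp2 hG hκ
    (fun μ _ => addMonoidHom_eq_zero_of_not_dvd_card' hp hh hpV μ)
    (fun v hv x hx => geomTorsion_fixed_eq_zero_of_geomPrimaryTorsion W p v (hc3 v hv) x hx) n

end Literature.NumberTheory.EllipticCurves.DeoRaySujatha2023

end
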